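import Mathlib
import HarnessLib
import HarnessLib.Audit
import Summits.PneNP.Statement
import Literature.Computability.Complexity.RandomCNF
import HarnessLib.Audit.Status.Attr

/-!
Route: ForcedSplits

DORMANT since 2026-08-22T19:40:49Z (reconciler: no traction for 5.6 d (last activity item-evidence-added at 2026-08-17T04:28:30Z); parked, not closed — `ledger route dormant route-PneNP-ForcedSplits --off` to reactivate) — unstaffed, not closed; items shared with open routes are served there. `ledger route dormant <id> --off` reactivates.

# Route ForcedSplits — forced splits: along the unit-propagation-guided restriction flow every
poly-time SAT-complete labelling contradicts itself at rate n^-C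

It suffices to show X = FLOW DEFECT FLOOR (card forced-splits-up-guided-flux, engine repaired after
triage-14): for every
polynomial-time predicate f that accepts (the encoding of) EVERY satisfiable CNF, the wrapped
labelling g(ψ) := f(ψ) ∧ [no empty
clause in ψ] violates the splitting identity (E) g(ψ) = g(ψ|v=0) ∨ g(ψ|v=1) with non-negligible mass
along the UP-GUIDED FLOW:
there is C with E[#steps of the path at which (E) fails] ≥ n^-C for infinitely many n. The flow:
root φ ~ F₃(n, 6n) (i.i.d.
clauses, `randomKCNF 3 n (6*n)`), a uniform variable order π and uniform values β; at node ψ: stop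
if [] ∈ ψ; else if ψ has a unit
clause set its literal true (forced step); else set the π-next unassigned variable v := β v (free
step); node = the simplified
restriction (a CNF, history-free). X is label-free and witness-free: it only asks a fast algorithm
to agree with itself.
Lean: `let restrict : Literature.Computability.Complexity.CNF ℕ → ℕ → Bool →
Literature.Computability.Complexity.CNF ℕ := fun ψ v b => (ψ.filter fun c => decide ((v, b) ∉
c)).map fun c => c.filter fun l => decide (l ≠ (v, !b)); let step : (n : ℕ) → Equiv.Perm (Fin n) →
(Fin n → Bool) → Literature.Computability.Complexity.CNF ℕ × List
(Literature.Computability.Complexity.CNF ℕ × ℕ × Bool × Bool) →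
Literature.Computability.Complexity.CNF ℕ × List (Literature.Computability.Complexity.CNF ℕ × ℕ ×
Bool × Bool) := fun n π β s => if ([] : Literature.Computability.Complexity.Clause ℕ) ∈ s.1 then s
else (match s.1.find? fun c => c.length == 1 with | some c => (match c.head? with | some l =>
(restrict s.1 l.1 l.2, (s.1, l.1, l.2, true) :: s.2) | none => s) | none => (match (List.finRange
n).find? fun i => decide ((π i : ℕ) ∉ s.2.map fun r => r.2.1) with | some i => (restrict s.1 (π i)
(β (π i)), (s.1, ((π i : Fin n) : ℕ), β (π i), false) :: s.2) | none => s)); let run : (n : ℕ) →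
Literature.Computability.Complexity.CNF ℕ × Equiv.Perm (Fin n) × (Fin n → Bool) →
Literature.Computability.Complexity.CNF ℕ × List (Literature.Computability.Complexity.CNF ℕ × ℕ ×
Bool × Bool) := fun n ω => (step n ω.2.1 ω.2.2)^[n] (ω.1, []); let J : (n : ℕ) → PMF
(Literature.Computability.Complexity.CNF ℕ × Equiv.Perm (Fin n) × (Fin n → Bool)) := fun n =>
(Literature.Computability.Complexity.randomKCNF 3 n (6 * n)).bind fun φ => (PMF.uniformOfFintype
(Equiv.Perm (Fin n) × (Fin n → Bool))).map fun r => (φ, r); let nviol : (n : ℕ) →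
(Literature.Computability.Complexity.CNF ℕ → Bool) → Literature.Computability.Complexity.CNF ℕ ×
Equiv.Perm (Fin n) × (Fin n → Bool) → ℕ := fun n g ω => (run n ω).2.countP fun r => g r.1 != (g
(restrict r.1 r.2.1 false) || g (restrict r.1 r.2.1 true)); ∀ f : List Bool → Bool,
Literature.Computability.Complexity.IsPolyTimePred f → (∀ φ :
Literature.Computability.Complexity.CNF ℕ, φ.Satisfiable → f
(Literature.Computability.Complexity.encodingCNF.encode φ) = true) → ∃ C : ℕ, ∃ᶠ n : ℕ in
Filter.atTop, ((n : ENNReal)⁻¹) ^ C ≤ ∑' ω, J n ω * (nviol n (fun ψ => f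
(Literature.Computability.Complexity.encodingCNF.encode ψ) && decide (([] :
Literature.Computability.Complexity.Clause ℕ) ∉ ψ)) ω : ENNReal)`

## Assembly
Pure logic plus proved tree facts: from ¬PneNP every L ∈ NP Bool is in P Bool; SAT ∈
Nondeterministic.NP (SAT_mem_NP, proved as
SAT_mem_NP_holds) and NP_bool_eq (proved as NP_bool_eq_holds) give a poly-time f with f w = true ↔ w
∈ SAT, which accepts exactly the
satisfiable CNFs (mem_SAT_iff); its wrapped labelling is [ψ satisfiable], and Satisfiable ψ ↔
Satisfiable ψ|v=0 ∨ Satisfiable ψ|v=1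
for the inlined restrict (any v), so every step is violation-free, the violation mass is 0 for every
n, and `∃ᶠ n, n^-C ≤ 0` is
false ((n:ℝ≥0∞)⁻¹ ^ C > 0) — contradiction with X. No analysis of the flow is needed (the violation
predicate vanishes pointwise).

Rationale: WHY THIS LINE. The ACCOUNTING LEMMA (item AccountingLemma, elementary) turns self-consistency into
soundness on this flow: on an unsatisfiable
root accepted by g the label sequence runs from 1 to 0, every resurrection and every drop at a
forced step violates (E) (the
forced sibling contains the empty clause), so a violation-free path is CLEAN — one drop, at a free
step, one-sided; hence small
violation mass ⇒ g rejects most random roots unless its acceptance set admits clean exits, which the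
DENSE CLEAN-EXIT BOUND
(crux CleanExitBound, a statement about one explicit Markov chain with no algorithm in it) forbids
at polynomial scale; with
Feige's hypothesis at Δ = 6 (tree: `FeigeHypothesis`, Feige2002 §1 Hyp. 1) this sandwiches X: FH6 ∧
C1 ⇒ X ⇒ P ≠ NP (items
Sandwich, Assembly). Imported areas: probabilistic combinatorics of the UC / ordered-DLL trajectory
on random 3-SAT
(ChaoFranco1986, FriezeSuen1996, Achlioptas2001, AchlioptasEtAl2001, CoccoMonasson2001,
AchlioptasBeameMolloy2004; 2-SAT scaling
window BollobasEtAl2001), optional-stopping / first-passage reasoning for the exit event, and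
program self-testing read backwards
(BlumKannan1995, RubinfeldSudan1996: robustness of a functional equation, here (E)+(B), whose exact
solution is SAT). What prior
routes do not do: Feige/ProofSpaceOGP/WitnessForging bound SOUND refuters, proof systems or
samplers; here the measured quantity is
a consistency defect of an arbitrary labelling, and unit propagation supplies the forced two-sided
splits that the refuted
random-value flow (retired card self-reduction-defect-flux, triage-14: f_j = [no depth-j refutation]
exits one-sidedly) lacked —
on this flow f_j drops at propagation steps and is unclean with probability ≈ 1.

RANKED CRUXES. #0 FlowDefectFloor (target) — X as in § Thesis: every poly-time f accepting all
satisfiable CNFs has, for some C, (E)-violation mass ≥ n^-C along the UP-guided flow from F₃(n,6n)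
for infinitely many n (wrapper g = f ∧ [no empty clause]). (why it might fail: False iff some
poly-time labelling accepting every satisfiable CNF has superpolynomially small violation mass; by
AccountingLemma + CleanExitBound that labelling is a Feige refuter at Δ = 6, so X is FH6-hard to
refute and P≠NP-hard to prove.) [Feige2002, BlumKannan1995, RubinfeldSudan1996,
AchlioptasBeameMolloy2004]
#2 CleanExitBound (crux) — DENSE CLEAN-EXIT BOUND (card C1, dense form). There are c, N such that
for all n ≥ N and every labelling g : CNF → Bool vanishing on formulas with the empty clause, if g
accepts ≥ 1/3 of the roots of F₃(n,6n) then with probability ≥ n^-c the UP-guided path is UNCLEAN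
for g: g(root) = true but the label sequence is not of the form 1…10…0 with its unique drop at a
free step whose sibling is labelled true. No complexity bound on g; g may depend on n. [difficulty:
XL] (why it might fail: A dense history-free labelling with one-sided self-stabilising exits: marker
adversaries (rare 2-clauses on low-index variables; width-2 clauses among the first K) already reach
unclean ≈ n^-1/2; the anti-correlated statistic S−R crosses one-sidedly — add re-crossing
suppression and it is n^-ω(1).) [FriezeSuen1996, ChaoFranco1986, Achlioptas2001, AchlioptasEtAl2001,
BollobasEtAl2001, CoccoMonasson2001]
#3 HereditaryCleanExit (crux) — the same bound for HEREDITARY labellings only (rejection closed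
under restriction: g ψ = false ⇒ g (ψ|v=b) = false) — the class of all refutation-search deciders
([no UP conflict], [no resolution refutation of width ≤ w / size ≤ S], [no unsat core ≤ s],
triage-14's f_j, any DPLL/CDCL run to a budget with sound caching). For these, unclean = (first
entrance into the rejection ideal happens at a forced step) ∨ (it is two-sided): a first-passage
statement (card principle P1). [deps: CleanExitBound] [difficulty: L] (why it might fail: An
absorbing straddle: a restriction-closed rejection ideal whose two children enter in an
anti-correlated way (e.g. exact size-budget boundaries of 'has a refutation of size ≤ S', or
parity-type ideals) could make first entrance one-sided with probability 1 − n^-ω(1).)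
[AchlioptasBeameMolloy2004, ChvatalSzemeredi1988, BenSassonWigderson2001, Achlioptas2001]
#4 UPCleanExit (crux) — the bound for the single labelling gUP = [unit propagation reaches no empty
clause]: with probability ≥ n^-c the first UP-inconsistent node of the UP-guided path from F₃(n,6n)
is entered by a TWO-SIDED free step, i.e. the fatal free variable is doubly failed (both literals
failed) in its parent. The cheapest instance of CleanExitBound and the first unconditional rung
(card C2(ii); conjectured exponent 1/3 from the 2-SAT scaling window, ≥ Θ(1/n) from the subcritical
phase alone). [deps: HereditaryCleanExit] [difficulty: L] (why it might fail: Only if failed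
literals x, ¬x are strongly anti-correlated at the first conflict of the UC trajectory at density 6;
the subcritical second-moment heuristic (doubly-failed variables ≈ c/N, picked w.p. 1/N per step
over Θ(n) steps) gives Θ(1/n); toy runs ≈ n^-0.45 for n ≤ 500.) [ChaoFranco1986, FriezeSuen1996,
Achlioptas2001, BollobasEtAl2001, AchlioptasEtAl2001]
#9 AccountingLemma (support) — ACCOUNTING LEMMA (the engine, elementary, provable now): for every n
and every labelling g vanishing on formulas with the empty clause, Pr[root unsatisfiable ∧ g(root) =
true ∧ path unclean for g] ≤ E[number of steps of the path at which (E) fails for g]. Proof: the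
label sequence of an accepted unsat root starts at 1 and ends at 0 (the final node contains []); a
0→1 step violates (E) at its parent; a 1→0 forced step violates (E) because the sibling contains the
empty clause; so a violation-free path has exactly one drop, at a free step, one-sided = clean;
indicator ≤ count. [difficulty: provable-now] [forced-splits-up-guided-flux (card, accounting
lemma), RubinfeldSudan1996]
#9 Sandwich (support) — CALIBRATION GLUE (provable now): CleanExitBound → AccountingLemma →
FeigeHypothesis 6 → FlowDefectFloor. If f ∈ FP accepts all satisfiable CNFs and has violation mass <
n^-(c+2) eventually, then Pr[unsat ∧ accepted ∧ unclean] < n^-(c+2) and Pr[sat] ≤ (2·(7/8)^6)^n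
(tree: card_le_of_forall_satisfiable), so Pr[unclean] < n^-c, so by CleanExitBound g accepts < 1/3
of F₃(n,6n); roots have no empty clause, so ¬f is a sound refuter (tree: IsSoundRefuter; negation
closure via PolyTimeDecidable.compl_holds) accepting > 2/3 ≥ 1/2 eventually — contradicting
FeigeHypothesis 6 (⌈6·n⌉₊ = 6n). [difficulty: provable-now] [Feige2002, ChvatalSzemeredi1988]

TWO-LAYER PLAN. Foreseen split 1 (as soon as CleanExitBound closes as proved): FlowDefectFloor ⇐
CleanExitBound → AccountingLemma →
`Literature.Computability.Complexity.FeigeHypothesis 6` → FlowDefectFloor, glue = Sandwich (provable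
now); the child FeigeHypothesis 6
is route Feige's thesis at Δ = 6 (shared decl, wanted_by both). Foreseen split 2 (if
HereditaryCleanExit closes first): CleanExitBound ⇐
HereditaryCleanExit → HereditaryDomination → CleanExitBound, where HereditaryDomination = "every
dense labelling is, up to a factor n^c in
unclean probability, dominated by the hereditary labelling of its restriction-closed rejection core"
(card principle P2: non-hereditary
exits are created at rate p and consumed at rate ≥ 1/n, unclean ≳ p + 1/(pn)). Nothing here is filed
now.

KILL CRITERIA. ¬CleanExitBound witnessed by a POLYNOMIAL-TIME dense labelling closes the route
(close --reason refuted:CleanExitBound): the engine is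
dead and X reduces to soundness arguments already owned by route Feige. ¬CleanExitBound by a
labelling outside P forces a pivot, not a
close: restate the crux over poly-time g (tenure restate). ¬UPCleanExit closes outright (it is
implied by both cruxes above). ¬X
(a poly-time SAT-complete labelling with superpolynomially small violation mass) closes outright. A
proof of ¬FeigeHypothesis 6 does
not refute X but voids the calibration (Sandwich becomes vacuous); a proof of FeigeHypothesis 6
elsewhere makes X follow from
CleanExitBound alone — and already proves PneNP via route Feige (then this route is superseded).

NOT DECOMPOSED YET. Exponents (c = 1/2 necessary by the marker family, c = 1 conjectured for
hereditary labellings, π₂(n) = n^-1/3 for gUP: card C2) —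
calibration children later; the RESOLUTION RUNG (card C3: every labelling at least as generous as
width-w / size-n^C resolution is
unclean w.p. ≥ n^-c, via the (2+p) proof-complexity threshold AchlioptasBeameMolloy2004 +
ChvatalSzemeredi1988) — a layer-2 child of
HereditaryCleanExit; the distributional (W)/quiet-planting TESTER form of X (Def as a samplable
statistic) — not needed for PneNP;
k > 3, densities in (α_sat, 8 ln 2], randomized (BPP) labellings, and named definitions for
restrict/step/run/clean (everything is
inlined now; a prover who wants API may propose `Summits/PneNP/PneNP/Theorems/ForcedSplitsFlow.lean`
with `--supports`).

CHEAPEST FALSIFIER. Simulate gUP on the exact flow of the items (ordered DLL, first unit clause,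
F₃(n,6n)) for n = 10³…10⁵ and fit Pr[fatal variable doubly
failed]: decay faster than every polynomial kills UPCleanExit and with it both cruxes above (the
card's smoke runs at α = 5 give
0.45@60 … 0.175@500 ≈ n^-0.45; an 8000-path sweep was left pending at filing; kit was not available
to this planner seat). On paper:
a refuter should first try to build a DENSE history-free labelling with unclean = n^-ω(1) from the
anti-correlated statistic
S − R (#2-clauses minus #removed clauses, whose free-step increments on the two children are exact
negatives while clauses have width 3)
— the planner's attempts all pay Θ(1) in re-crossings or two-sided boundary moves (NOTES.md
§Adversary census).

NUMBERS. Density 6 > 8 ln 2 ≈ 5.545 (first moment: Pr[F₃(n,6n) satisfiable] ≤ (2(7/8)^6)^n ≈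
0.898^n, tree card_le_of_forall_satisfiable;
ChvatalSzemeredi1988 §1); α_sat(3) ≈ 4.267 (MezardParisiZecchina2002, not used); UC succeeds w.p.
bounded below only for α < 8/3
(ChaoFranco1986), so at α = 6 the path hits a contradiction at T ≈ θ*·n with θ* < 1 and a constant
fraction of forced steps before T;
2-SAT scaling window n^-1/3 (BollobasEtAl2001 Thm 1.1) behind the conjectured π₂(n) = n^-1/3;
adversary floor: marker families reach
unclean ≈ C·n^-1/2 (card: 0.85@80, 0.725@60, 0.30@500), so c ≥ 1/2 in CleanExitBound; loss in the
sandwich: C = c + 2.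

DEFINITION REQUESTS. None required at open: restrict / step / run / J / nviol / clean / gUP are
inlined `let`s over `Literature.Computability.Complexity.CNF`,
`randomKCNF`, `PMF.uniformOfFintype`, `Equiv.Perm (Fin n)` (Sketch.lean rc 0; #guard tests in the
planner folder). Facts used by the
glue are all PROVED in the tree: SAT_mem_NP_holds, NP_bool_eq_holds, mem_SAT_iff,
card_le_of_forall_satisfiable,
PolyTimeDecidable.compl_holds, isPolyTimePred_iff. The only unproved named Prop touched is
FeigeHypothesis 6, and only inside the
calibration item Sandwich (as a hypothesis), never in the assembly.

Novelty: Searches (2026-08-15): `lit search "unit clause heuristic random 3-SAT probabilistic analysis unit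
propagation contradiction"` (local 1:
arXiv:cs/0401011 Cocco–Monasson; crossref 12 incl. doi:10.1016/0020-0255(90)90030-e Chao–Franco
1990); `lit search --hybrid "downward
self-reducibility consistency test soundness program checker satisfiability"` (10 textbook hits,
Arora–Barak pp.198–199 program checking,
nothing on restriction flows); `lit vsearch "<consistency of a labelling with f(F)=f(F|x=0)∨f(F|x=1)
along random partial assignments>"`
(10 generic hits: Jukna 2012, Arora–Barak, Bonacina 2017); `lit galaxy search "unit-clause
heuristic" --star all` (2 irrelevant),
`lit galaxy search "myopic algorithms" --star pdf` (12; relevant: ECCC TR09-038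
Alekhnovich–Borodin–Buresh-Oppenheim–Impagliazzo–Magen–
Pitassi, priority branching trees = lower bounds for DPLL-like algorithm CLASSES); `lit frontier
PneNP --since 2020` (30, proof-complexity
/ meta-complexity, none on UC flows); `lit bridges PneNP --cross any` (30 generic); `ledger
negatives --problem PneNP` (1, unrelated);
the 42 PneNP theses and the retired-card grade note (triage-14). OpenAlex/S2 were rate-limited;
crossref/zbMATH/local answered.
Nearest prior art found: the retired card self-reduction-defect-flux (framing (E)/(B), credited; its
random-value engine refuted);
UC / ordered-DLL trajectory analyses ChaoFranco1986 (doi:10.1137/0215080), FriezeSuen1996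
(doi:10.1006/jagm.1996.0016), Achlioptas2001,
AchlioptasEtAl2001,  [refs: 10.1016/0020-0255(90, 10.1137/0215080, 10.1006/jagm.1996.0016, 10.1016/j.jcss.2003.07.011, cs/0401011, doi:10.1016/0020-0255, doi:10.1137/0215080, doi:10.1006/jagm.1996.0016, doi:10.1016/j.jcss.2003.07.011, ChaoFranco1986, FriezeSuen1996, Achlioptas2001, AchlioptasEtAl2001, CoccoMonasson2001, AchlioptasBeameMolloy2004, BlumKannan1995, RubinfeldSudan1996]

Barriers (technique_class: random-restrictions, optional-stopping, defect-bounds): - technique_class: random-restrictions, optional-stopping, defect-bounds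
- Literature.Barriers.PneNP.Relativization: applies to the target and is relocated, not evaded — the
Assembly and the Sandwich relativize (an oracle making P = NP yields a zero-defect complete
labelling relative to it), so X fails relative to such oracles and any proof of X is
non-relativizing; the bet is that the non-relativizing content sits in CleanExitBound-type
statements about an explicit product measure and an explicit chain, reached by probabilistic
combinatorics that oracle arguments do not see. Same remark for
Literature.Barriers.PneNP.BoundedRelativization and Literature.Barriers.PneNP.Algebrization (nothing
is arithmetised).
- Literature.Barriers.PneNP.NaturalProofs: does not apply to the cruxes
(CleanExitBound/Hereditary/UP are statements about one distribution on formulas and contain no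
circuit class); for the target, a defect floor against FP is a property of uniform algorithms
measured on sampled instances, not a large constructive property of truth tables — but nothing in
the route USES uniformity, so against P/poly-labellings the natural-proofs obstruction is flagged
unverified rather than evaded (as for route Feige). Literature.Barriers.PneNP.NaturalProofsTC0: same
status.
- Literature.Barriers.PneNP.NPHardnessToOneWayFunctions: not met — no worst-case-to-average-case
reduction is claimed; the Sandwich goes average-case (FeigeHypothesis 6) to average-case (X);
Bogdanov–Trevisan / AGGM-

History (route lifecycle, newest last):
- 2026-08-15T16:16:34Z · rev 3: restated Assembly (stmt-PneNP-8180) — route-repair (glue): Assembly restated NP_bool_eq → SAT_mem_NP → FlowDefectFloor → PneNP  ⟶  FlowDefectFloor → PneNP (the two dropped hypotheses are PROVED fact (planner-rbadge-PneNP-ForcedSplits-ef12f5ed-g2-0)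
- 2026-08-16T02:18:21Z · AUTO-CRUX: 1 conjecture-grade item(s) promoted to crux (UPCleanExit) — refuter vetting / tiering apply (operator:999:1362873)
- 2026-08-16T04:14:06Z · AUTO-CRUX (backfill): FlowDefectFloor — hypotheses of the deciding theorem that nothing in the route derives are cruxes (operator:999:1085951)
- 2026-08-22T19:40:49Z · DORMANT — reconciler: no traction for 5.6 d (last activity item-evidence-added at 2026-08-17T04:28:30Z); parked, not closed — `ledger route dormant route-PneNP-ForcedSpli (operator:999:4109232)

sub-problem: PneNP · status: dormant · opened planner-plancard-PneNP-PneNP-forced-splits-up-37317fc9-0 2026-08-15T12:32:05Z · rev 3 · ledger route-PneNP-ForcedSplits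
GENERATED by the gate from the ledger (D-0016/17). Provers cite these decls: `theorem foo : Summit.PneNP.PneNP.Theses.ForcedSplits.<Decl> := …` in Summits/PneNP/PneNP/Theorems/<Name>.lean.
-/

namespace Summit.PneNP.PneNP.Theses.ForcedSplits

open scoped BigOperators Topology Manifold Classical MeasureTheory ProbabilityTheory Matrix InnerProductSpace ComplexConjugate ContinuousMap
open Filter Set Function TopologicalSpace MeasureTheory

attribute [summit_statement] _root_.PneNP

open Literature.PNP

/-- item stmt-PneNP-8174 · crux (kind.auto-crux: conjecture-grade) · rank 0 · open · by planner
why it might fail: ¬X = a poly-time f ⊇ SAT with (E)-violation mass n^-ω(1) on the UP-guided flow; by AccountingLemma such an f is either a sound refuter accepting ≥2/3 of F₃(n,6n) (¬FeigeHypothesis 6) or a poly-time clean-exiter (¬CleanExitBound). NB the items reach X only through FeigeHypothesis 6 (Sandwich).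
sources: Feige2002, AchlioptasBeameMolloy2004, BlumKannan1995, RubinfeldSudan1996
[target] X as in § Thesis: every poly-time f accepting all satisfiable CNFs has, for some C,
(E)-violation mass ≥ n^-C along the UP-guided flow from F₃(n,6n) for infinitely many n (wrapper g =
f ∧ [no empty clause]). -/
@[route_item "route-PneNP-ForcedSplits", crux]
def FlowDefectFloor : Prop :=
  let restrict : Literature.Computability.Complexity.CNF ℕ → ℕ → Bool → Literature.Computability.Complexity.CNF ℕ := fun ψ v b => (ψ.filter fun c => decide ((v, b) ∉ c)).map fun c => c.filter fun l => decide (l ≠ (v, !b)); let step : (n : ℕ) → Equiv.Perm (Fin n) → (Fin n → Bool) → Literature.Computability.Complexity.CNF ℕ × List (Literature.Computability.Complexity.CNF ℕ × ℕ × Bool × Bool) → Literature.Computability.Complexity.CNF ℕ × List (Literature.Computability.Complexity.CNF ℕ × ℕ × Bool × Bool) := fun n π β s => if ([] : Literature.Computability.Complexity.Clause ℕ) ∈ s.1 then s else (match s.1.find? fun c => c.length == 1 with | some c => (match c.head? with | some l => (restrict s.1 l.1 l.2, (s.1, l.1, l.2, true) :: s.2) | none => s) | none => (match (List.finRange n).find?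 fun i => decide ((π i : ℕ) ∉ s.2.map fun r => r.2.1) with | some i => (restrict s.1 (π i) (β (π i)), (s.1, ((π i : Fin n) : ℕ), β (π i), false) :: s.2) | none => s)); let run : (n : ℕ) → Literature.Computability.Complexity.CNF ℕ × Equiv.Perm (Fin n) × (Fin n → Bool) → Literature.Computability.Complexity.CNF ℕ × List (Literature.Computability.Complexity.CNF ℕ × ℕ × Bool × Bool) := fun n ω => (step n ω.2.1 ω.2.2)^[n] (ω.1, []); let J : (n : ℕ) → PMF (Literature.Computability.Complexity.CNF ℕ × Equiv.Perm (Fin n) × (Fin n → Bool)) := fun n => (Literature.Computability.Complexity.randomKCNF 3 n (6 * n)).bind fun φ => (PMF.uniformOfFintype (Equiv.Perm (Fin n) × (Fin n → Bool))).map fun r => (φ, r); let nviol : (n : ℕ) → (Literature.Computability.Complexity.CNF ℕ → Bool) → Literature.Computability.Complexity.CNF ℕ × Equiv.Perm (Fin n) × (Fin n → Bool) → ℕ := fun n g ω => (run n ω).2.countP fun r => g r.1 != (g (restrict r.1 r.2.1 false) || g (restrict r.1 r.2.1 true)); ∀ f : List Bool → Bool, Literature.Computability.Complexity.IsPolyTimePred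 f → (∀ φ : Literature.Computability.Complexity.CNF ℕ, φ.Satisfiable → f (Literature.Computability.Complexity.encodingCNF.encode φ) = true) → ∃ C : ℕ, ∃ᶠ n : ℕ in Filter.atTop, ((n : ENNReal)⁻¹) ^ C ≤ ∑' ω, J n ω * (nviol n (fun ψ => f (Literature.Computability.Complexity.encodingCNF.encode ψ) && decide (([] : Literature.Computability.Complexity.Clause ℕ) ∉ ψ)) ω : ENNReal)

/-- item stmt-PneNP-8175 · crux · rank 2 · open · by planner
why it might fail: Refuted by a dense history-free g exiting one-sidedly w.p. 1−n^-ω(1). Exclusive statistics (S−R: a child's new 2-clauses = its sibling's removed clauses) never drop two-sidedly but drift toward 'alive': random-walk persistence ≈n^-1/2, then forced death; harmonic thresholds re-cross. Open beyond.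
sources: FriezeSuen1996, Achlioptas2001, AchlioptasEtAl2001, ChaoFranco1986, BollobasEtAl2001, KorteVygen2018
[crux] DENSE CLEAN-EXIT BOUND (card C1, dense form). There are c, N such that for all n ≥ N and
every labelling g : CNF → Bool vanishing on formulas with the empty clause, if g accepts ≥ 1/3 of
the roots of F₃(n,6n) then with probability ≥ n^-c the UP-guided path is UNCLEAN for g: g(root) =
true but the label sequence is not of the form 1…10…0 with its unique drop at a free step whose
sibling is labelled true. No complexity bound on g; g may depend on n. [difficulty: XL] -/
@[route_item "route-PneNP-ForcedSplits", crux]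
def CleanExitBound : Prop :=
  let restrict : Literature.Computability.Complexity.CNF ℕ → ℕ → Bool → Literature.Computability.Complexity.CNF ℕ := fun ψ v b => (ψ.filter fun c => decide ((v, b) ∉ c)).map fun c => c.filter fun l => decide (l ≠ (v, !b)); let step : (n : ℕ) → Equiv.Perm (Fin n) → (Fin n → Bool) → Literature.Computability.Complexity.CNF ℕ × List (Literature.Computability.Complexity.CNF ℕ × ℕ × Bool × Bool) → Literature.Computability.Complexity.CNF ℕ × List (Literature.Computability.Complexity.CNF ℕ × ℕ × Bool × Bool) := fun n π β s => if ([] : Literature.Computability.Complexity.Clause ℕ) ∈ s.1 then s else (match s.1.find? fun c => c.length == 1 with | some c => (match c.head? with | some l => (restrict s.1 l.1 l.2, (s.1, l.1, l.2, true) :: s.2) | none => s) | none => (match (List.finRange n).find? fun i => decide ((π i : ℕ) ∉ s.2.map fun r => r.2.1) with | some i => (restrict s.1 (π i) (β (π i)), (s.1, ((π i : Fin n) : ℕ), β (π i), false) :: s.2) | none => s)); let run : (n : ℕ) → Literature.Computability.Complexity.CNF ℕ × Equiv.Perm (Fin n) × (Fin n → Bool) → Literature.Computability.Complexity.CNF ℕ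 × List (Literature.Computability.Complexity.CNF ℕ × ℕ × Bool × Bool) := fun n ω => (step n ω.2.1 ω.2.2)^[n] (ω.1, []); let J : (n : ℕ) → PMF (Literature.Computability.Complexity.CNF ℕ × Equiv.Perm (Fin n) × (Fin n → Bool)) := fun n => (Literature.Computability.Complexity.randomKCNF 3 n (6 * n)).bind fun φ => (PMF.uniformOfFintype (Equiv.Perm (Fin n) × (Fin n → Bool))).map fun r => (φ, r); let clean : (n : ℕ) → (Literature.Computability.Complexity.CNF ℕ → Bool) → Literature.Computability.Complexity.CNF ℕ × Equiv.Perm (Fin n) × (Fin n → Bool) → Prop := fun n g ω => ∃ a : ℕ, a < (run n ω).2.length ∧ (∀ t : ℕ, t ≤ (run n ω).2.length → ((((run n ω).2.reverse.map fun r => g r.1) ++ [g (run n ω).1]).getD t false = true ↔ t ≤ a)) ∧ ((run n ω).2.reverse.getD a ([], 0, false, false)).2.2.2 = false ∧ g (restrict ((run n ω).2.reverse.getD a ([], 0, false, false)).1 ((run n ω).2.reverse.getD a ([], 0, false, false)).2.1 (!((run n ω).2.reverse.getD a ([], 0, false, false)).2.2.1)) = true; ∃ c N : ℕ, ∀ n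 ≥ N, ∀ g : Literature.Computability.Complexity.CNF ℕ → Bool, (∀ ψ : Literature.Computability.Complexity.CNF ℕ, ([] : Literature.Computability.Complexity.Clause ℕ) ∈ ψ → g ψ = false) → (1 / 3 : ENNReal) ≤ (J n).toOuterMeasure {ω | g ω.1 = true} → ((n : ENNReal)⁻¹) ^ c ≤ (J n).toOuterMeasure {ω | g ω.1 = true ∧ ¬ clean n g ω}

/-- item stmt-PneNP-8176 · crux · rank 3 · open · by planner
why it might fail: Heredity kills resurrection; forced-safety forces I ⊇ I_UP closed under UP-predecessors ('UP-refutable or has a doubly-failed variable' qualifies). A forced-safe down-closed ideal with EXCLUSIVE free-step entrances w.p. 1−n^-ω(1) refutes it; independent entrances give only ≳log²n/n (Cauchy–Schwarz).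
sources: AchlioptasBeameMolloy2004, BenSassonWigderson2001, ChvatalSzemeredi1988, AchlioptasEtAl2001, arXiv:cond-mat/0508125
[crux] the same bound for HEREDITARY labellings only (rejection closed under restriction: g ψ =
false ⇒ g (ψ|v=b) = false) — the class of all refutation-search deciders ([no UP conflict], [no
resolution refutation of width ≤ w / size ≤ S], [no unsat core ≤ s], triage-14's f_j, any DPLL/CDCL
run to a budget with sound caching). For these, unclean = (first entrance into the rejection ideal
happens at a forced step) ∨ (it is two-sided): a first-passage statement (card principle P1). [deps:
CleanExitBound] [difficulty: L] -/
@[route_item "route-PneNP-ForcedSplits", crux]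
def HereditaryCleanExit : Prop :=
  let restrict : Literature.Computability.Complexity.CNF ℕ → ℕ → Bool → Literature.Computability.Complexity.CNF ℕ := fun ψ v b => (ψ.filter fun c => decide ((v, b) ∉ c)).map fun c => c.filter fun l => decide (l ≠ (v, !b)); let step : (n : ℕ) → Equiv.Perm (Fin n) → (Fin n → Bool) → Literature.Computability.Complexity.CNF ℕ × List (Literature.Computability.Complexity.CNF ℕ × ℕ × Bool × Bool) → Literature.Computability.Complexity.CNF ℕ × List (Literature.Computability.Complexity.CNF ℕ × ℕ × Bool × Bool) := fun n π β s => if ([] : Literature.Computability.Complexity.Clause ℕ) ∈ s.1 then s else (match s.1.find? fun c => c.length == 1 with | some c => (match c.head? with | some l => (restrict s.1 l.1 l.2, (s.1, l.1, l.2, true) :: s.2) | none => s) | none => (match (List.finRange n).find? fun i => decide ((π i : ℕ) ∉ s.2.map fun r => r.2.1) with | some i => (restrict s.1 (π i) (β (π i)), (s.1, ((π i : Fin n) : ℕ), β (π i), false) :: s.2) | none => s)); let run : (n : ℕ) → Literature.Computability.Complexity.CNF ℕ × Equiv.Perm (Fin n) × (Fin n → Bool) → Literature.Computability.Complexity.CNF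 ℕ × List (Literature.Computability.Complexity.CNF ℕ × ℕ × Bool × Bool) := fun n ω => (step n ω.2.1 ω.2.2)^[n] (ω.1, []); let J : (n : ℕ) → PMF (Literature.Computability.Complexity.CNF ℕ × Equiv.Perm (Fin n) × (Fin n → Bool)) := fun n => (Literature.Computability.Complexity.randomKCNF 3 n (6 * n)).bind fun φ => (PMF.uniformOfFintype (Equiv.Perm (Fin n) × (Fin n → Bool))).map fun r => (φ, r); let clean : (n : ℕ) → (Literature.Computability.Complexity.CNF ℕ → Bool) → Literature.Computability.Complexity.CNF ℕ × Equiv.Perm (Fin n) × (Fin n → Bool) → Prop := fun n g ω => ∃ a : ℕ, a < (run n ω).2.length ∧ (∀ t : ℕ, t ≤ (run n ω).2.length → ((((run n ω).2.reverse.map fun r => g r.1) ++ [g (run n ω).1]).getD t false = true ↔ t ≤ a)) ∧ ((run n ω).2.reverse.getD a ([], 0, false, false)).2.2.2 = false ∧ g (restrict ((run n ω).2.reverse.getD a ([], 0, false, false)).1 ((run n ω).2.reverse.getD a ([], 0, false, false)).2.1 (!((run n ω).2.reverse.getD a ([], 0, false, false)).2.2.1)) = true; ∃ c N : ℕ, ∀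 n ≥ N, ∀ g : Literature.Computability.Complexity.CNF ℕ → Bool, (∀ ψ : Literature.Computability.Complexity.CNF ℕ, ([] : Literature.Computability.Complexity.Clause ℕ) ∈ ψ → g ψ = false) → (∀ (ψ : Literature.Computability.Complexity.CNF ℕ) (v : ℕ) (b : Bool), g ψ = false → g (restrict ψ v b) = false) → (1 / 3 : ENNReal) ≤ (J n).toOuterMeasure {ω | g ω.1 = true} → ((n : ENNReal)⁻¹) ^ c ≤ (J n).toOuterMeasure {ω | g ω.1 = true ∧ ¬ clean n g ω}

/-- item stmt-PneNP-8177 · crux (kind.auto-crux: conjecture-grade) · rank 4 · open · by planner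
why it might fail: As typed (∃ c) it holds via a root gadget: with a=(π0,¬β0), clauses (a∨π1∨y),(a∨π1∨¬y),(a∨¬π1∨z),(a∨¬π1∨¬z) make steps 0,1 free and the step-1 gUP drop two-sided, Pr = Θ(n^-O(1)); the contentful exponent π₂(n) ∈ [n^-1, n^-1/3] (2-SAT window) needs an explicit c ≤ 1.
sources: ChaoFranco1986, FriezeSuen1996, AchlioptasEtAl2001, BollobasEtAl2001, arXiv:cond-mat/0508125
[crux] the bound for the single labelling gUP = [unit propagation reaches no empty clause]: with
probability ≥ n^-c the first UP-inconsistent node of the UP-guided path from F₃(n,6n) is entered by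
a TWO-SIDED free step, i.e. the fatal free variable is doubly failed (both literals failed) in its
parent. The cheapest instance of CleanExitBound and the first unconditional rung (card C2(ii);
conjectured exponent 1/3 from the 2-SAT scaling window, ≥ Θ(1/n) from the subcritical phase alone).
[deps: HereditaryCleanExit] [difficulty: L] -/
@[route_item "route-PneNP-ForcedSplits", crux]
def UPCleanExit : Prop :=
  let restrict : Literature.Computability.Complexity.CNF ℕ → ℕ → Bool → Literature.Computability.Complexity.CNF ℕ := fun ψ v b => (ψ.filter fun c => decide ((v, b) ∉ c)).map fun c => c.filter fun l => decide (l ≠ (v, !b)); let step : (n : ℕ) → Equiv.Perm (Fin n) → (Fin n → Bool) → Literature.Computability.Complexity.CNF ℕ × List (Literature.Computability.Complexity.CNF ℕ × ℕ × Bool × Bool) → Literature.Computability.Complexity.CNF ℕ × List (Literature.Computability.Complexity.CNF ℕ × ℕ × Bool × Bool) := fun n π β s => if ([] : Literature.Computability.Complexity.Clause ℕ) ∈ s.1 then s else (match s.1.find? fun c => c.length == 1 with | some c => (match c.head? with | some l => (restrict s.1 l.1 l.2, (s.1, l.1, l.2, true) :: s.2) | none => s) | none => (match (List.finRange n).find?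 fun i => decide ((π i : ℕ) ∉ s.2.map fun r => r.2.1) with | some i => (restrict s.1 (π i) (β (π i)), (s.1, ((π i : Fin n) : ℕ), β (π i), false) :: s.2) | none => s)); let run : (n : ℕ) → Literature.Computability.Complexity.CNF ℕ × Equiv.Perm (Fin n) × (Fin n → Bool) → Literature.Computability.Complexity.CNF ℕ × List (Literature.Computability.Complexity.CNF ℕ × ℕ × Bool × Bool) := fun n ω => (step n ω.2.1 ω.2.2)^[n] (ω.1, []); let J : (n : ℕ) → PMF (Literature.Computability.Complexity.CNF ℕ × Equiv.Perm (Fin n) × (Fin n → Bool)) := fun n => (Literature.Computability.Complexity.randomKCNF 3 n (6 * n)).bind fun φ => (PMF.uniformOfFintype (Equiv.Perm (Fin n) × (Fin n → Bool))).map fun r => (φ, r); let clean : (n : ℕ) → (Literature.Computability.Complexity.CNF ℕ → Bool) → Literature.Computability.Complexity.CNF ℕ × Equiv.Perm (Fin n) × (Fin n → Bool) → Prop := fun n g ω => ∃ a : ℕ, a < (run n ω).2.length ∧ (∀ t : ℕ, t ≤ (run n ω).2.length → ((((run n ω).2.reverse.map fun r => g r.1) ++ [g (run n ω).1]).getD t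 false = true ↔ t ≤ a)) ∧ ((run n ω).2.reverse.getD a ([], 0, false, false)).2.2.2 = false ∧ g (restrict ((run n ω).2.reverse.getD a ([], 0, false, false)).1 ((run n ω).2.reverse.getD a ([], 0, false, false)).2.1 (!((run n ω).2.reverse.getD a ([], 0, false, false)).2.2.1)) = true; let ustep : Literature.Computability.Complexity.CNF ℕ → Literature.Computability.Complexity.CNF ℕ := fun ψ => (match ψ.find? fun c => c.length == 1 with | some c => (match c.head? with | some l => restrict ψ l.1 l.2 | none => ψ) | none => ψ); let gUP : Literature.Computability.Complexity.CNF ℕ → Bool := fun ψ => !(decide (([] : Literature.Computability.Complexity.Clause ℕ) ∈ ustep^[(ψ.map List.length).sum] ψ)); ∃ c N : ℕ, ∀ n ≥ N, ((n : ENNReal)⁻¹) ^ c ≤ (J n).toOuterMeasure {ω | gUP ω.1 = true ∧ ¬ clean n gUP ω}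

/-- item stmt-PneNP-8178 · support · rank 9 · closed · proved by Summit.PneNP.PneNP.Theorems.forcedSplits_accountingLemma_proof @ fd6c08ab6456 (prover) · by planner
sources: forced-splits-up-guided-flux (card, accounting lemma), RubinfeldSudan1996
[support] ACCOUNTING LEMMA (the engine, elementary, provable now): for every n and every labelling g
vanishing on formulas with the empty clause, Pr[root unsatisfiable ∧ g(root) = true ∧ path unclean
for g] ≤ E[number of steps of the path at which (E) fails for g]. Proof: the label sequence of an
accepted unsat root starts at 1 and ends at 0 (the final node contains []); a 0→1 step violates (E)
at its parent; a 1→0 forced step violates (E) because the sibling contains the empty clause; so a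
violation-free path has exactly one drop, at a free step, one-sided = clean; indicator ≤ count.
[difficulty: provable-now] -/
@[route_item "route-PneNP-ForcedSplits", crux]
def AccountingLemma : Prop :=
  let restrict : Literature.Computability.Complexity.CNF ℕ → ℕ → Bool → Literature.Computability.Complexity.CNF ℕ := fun ψ v b => (ψ.filter fun c => decide ((v, b) ∉ c)).map fun c => c.filter fun l => decide (l ≠ (v, !b)); let step : (n : ℕ) → Equiv.Perm (Fin n) → (Fin n → Bool) → Literature.Computability.Complexity.CNF ℕ × List (Literature.Computability.Complexity.CNF ℕ × ℕ × Bool × Bool) → Literature.Computability.Complexity.CNF ℕ × List (Literature.Computability.Complexity.CNF ℕ × ℕ × Bool × Bool) := fun n π β s => if ([] : Literature.Computability.Complexity.Clause ℕ) ∈ s.1 then s else (match s.1.find? fun c => c.length == 1 with | some c => (match c.head? with | some l => (restrict s.1 l.1 l.2, (s.1, l.1, l.2, true) :: s.2) | none => s) | none => (match (List.finRange n).find? fun i => decide ((π i : ℕ) ∉ s.2.map fun r => r.2.1) with | some i => (restrict s.1 (π i) (β (π i)), (s.1, ((π i : Fin n) : ℕ), β (π i), false) :: s.2) | none => s)); let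 run : (n : ℕ) → Literature.Computability.Complexity.CNF ℕ × Equiv.Perm (Fin n) × (Fin n → Bool) → Literature.Computability.Complexity.CNF ℕ × List (Literature.Computability.Complexity.CNF ℕ × ℕ × Bool × Bool) := fun n ω => (step n ω.2.1 ω.2.2)^[n] (ω.1, []); let J : (n : ℕ) → PMF (Literature.Computability.Complexity.CNF ℕ × Equiv.Perm (Fin n) × (Fin n → Bool)) := fun n => (Literature.Computability.Complexity.randomKCNF 3 n (6 * n)).bind fun φ => (PMF.uniformOfFintype (Equiv.Perm (Fin n) × (Fin n → Bool))).map fun r => (φ, r); let nviol : (n : ℕ) → (Literature.Computability.Complexity.CNF ℕ → Bool) → Literature.Computability.Complexity.CNF ℕ × Equiv.Perm (Fin n) × (Fin n → Bool) → ℕ := fun n g ω => (run n ω).2.countP fun r => g r.1 != (g (restrict r.1 r.2.1 false) || g (restrict r.1 r.2.1 true)); let clean : (n : ℕ) → (Literature.Computability.Complexity.CNF ℕ → Bool) → Literature.Computability.Complexity.CNF ℕ × Equiv.Perm (Fin n) × (Fin n → Bool) → Prop := fun n g ω => ∃ a : ℕ, a < (run n ω).2.length ∧ (∀ t : ℕ,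 t ≤ (run n ω).2.length → ((((run n ω).2.reverse.map fun r => g r.1) ++ [g (run n ω).1]).getD t false = true ↔ t ≤ a)) ∧ ((run n ω).2.reverse.getD a ([], 0, false, false)).2.2.2 = false ∧ g (restrict ((run n ω).2.reverse.getD a ([], 0, false, false)).1 ((run n ω).2.reverse.getD a ([], 0, false, false)).2.1 (!((run n ω).2.reverse.getD a ([], 0, false, false)).2.2.1)) = true; ∀ n : ℕ, ∀ g : Literature.Computability.Complexity.CNF ℕ → Bool, (∀ ψ : Literature.Computability.Complexity.CNF ℕ, ([] : Literature.Computability.Complexity.Clause ℕ) ∈ ψ → g ψ = false) → (J n).toOuterMeasure {ω | ¬ ω.1.Satisfiable ∧ g ω.1 = true ∧ ¬ clean n g ω} ≤ ∑' ω, J n ω * (nviol n g ω : ENNReal)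

/-- item stmt-PneNP-8179 · support · rank 9 · closed · proved by Summit.PneNP.PneNP.Theorems.forcedSplits_sandwich_proof @ 72a5bf9103b6 (prover) · by planner
sources: Feige2002, ChvatalSzemeredi1988
[support] CALIBRATION GLUE (provable now): CleanExitBound → AccountingLemma → FeigeHypothesis 6 →
FlowDefectFloor. If f ∈ FP accepts all satisfiable CNFs and has violation mass < n^-(c+2)
eventually, then Pr[unsat ∧ accepted ∧ unclean] < n^-(c+2) and Pr[sat] ≤ (2·(7/8)^6)^n (tree:
card_le_of_forall_satisfiable), so Pr[unclean] < n^-c, so by CleanExitBound g accepts < 1/3 of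
F₃(n,6n); roots have no empty clause, so ¬f is a sound refuter (tree: IsSoundRefuter; negation
closure via PolyTimeDecidable.compl_holds) accepting > 2/3 ≥ 1/2 eventually — contradicting
FeigeHypothesis 6 (⌈6·n⌉₊ = 6n). [difficulty: provable-now] -/
@[route_item "route-PneNP-ForcedSplits", crux]
def Sandwich : Prop :=
  CleanExitBound → AccountingLemma → Literature.Computability.Complexity.FeigeHypothesis 6 → FlowDefectFloor

-- earlier Assembly (stmt-PneNP-8180, replaced 2026-08-15T16:16:34Z -> stmt-PneNP-10471): retired by None — Literature.Computability.Complexity.NP_bool_eq → Literature.Computability.Complexity.SAT_mem_NP → FlowDefectFloor → PneNP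
/-- item stmt-PneNP-10471 · assembly · rank 1 · closed · proved by Summit.PneNP.PneNP.Theorems.forcedSplits_assembly_proof @ 622e84d12951 (prover) · by planner
sources: Cook1971, Feige2002, AroraBarakCC2009
[assembly] FlowDefectFloor → PneNP (frame statement #1: X → Statement; the deciding theorem is
`closes := fun hX … hA => hA hX`). Provable now, pure logic plus PROVED tree facts used INSIDE the
proof (not assumed): by contradiction, ¬PneNP puts every L ∈ PNPWave0.NP Bool into PNPWave0.P Bool;
SAT ∈ Nondeterministic.NP (SAT_mem_NP_holds, NegCNFTranscoder.lean) and PNPWave0.NP Bool =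
Nondeterministic.NP (NP_bool_eq_holds, ClayProblemProofs.lean) give a poly-time f with f w = true ↔
w ∈ SAT, i.e. f (encodingCNF.encode φ) = true ↔ φ.Satisfiable (mem_SAT_iff); feed f to X: its
wrapped labelling g ψ = [ψ satisfiable] ∧ [[] ∉ ψ] = [ψ satisfiable] obeys g ψ = g (restrict ψ v
false) || g (restrict ψ v true) for every ψ, v (restriction lemma for the inlined restrict: a model
σ survives in the branch b = σ v; a model of a branch extends by v := b), so nviol ≡ 0 on every
path, the tsum is 0, and (n:ℝ≥0∞)⁻¹ ^ C ≤ 0 fails for every n, contradicting ∃ᶠ. Repair 2026-08-15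
(route-repair, glue.extra-hypothesis): the old Assembly took NP_bool_eq and SAT_mem_NP as
hypotheses; both are discharged facts and now enter only the proof, so the route file needs no
ClayProblem import. -/
@[route_item "route-PneNP-ForcedSplits", crux]
def Assembly : Prop :=
  FlowDefectFloor → PneNP

/-! D-0027 §2.1 — DECIDING THEOREM (planner-authored via `route open/edit --closes-file`; by planner-rbadge-PneNP-ForcedSplits-ef12f5ed-g2-0 2026-08-15T16:16:34Z):
its hypotheses are this route's items and its conclusion the sub-problem Statement (glue_lint), and it elaborates with this file. -/

@[closes "route-PneNP-ForcedSplits"] theorem closes : FlowDefectFloor → CleanExitBound → HereditaryCleanExit → UPCleanExit → AccountingLemma → Sandwich → Assembly → _root_.PneNP :=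
  fun hX _ _ _ _ _ hA => hA hX

end Summit.PneNP.PneNP.Theses.ForcedSplits
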